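import Literature.MathematicalPhysics.QuantumFieldTheory.Balaban1983to89.B15GammaSmallness

/-!
# `Balaban1983to89.B15GammaClauses` — [Balaban1989LargeFieldI] p. 186: *"Notice, that the conditions on M, γ, A₀, and A₁
# introduced above do not depend on any scale, i.e., on i, j, k, and so on. This applies also to other conditions
# introduced before"* and *"… can be made arbitrarily small by choosing γ … sufficiently small"* — the explicit γ-clauses
# of this block's files hold SIMULTANEOUSLY for every sufficiently small γ > 0, constants fixed; the two αβ-majorisations
# of (1.48) from γ

statement-level skeleton of published theorems with citation tags; proofs where landed; nothing here is a claim about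
the Yang–Mills mass gap.

CITATION HEADER (lean-in-tree rule 2026-08-18).  T. Bałaban, *Large field renormalization. I. The basic step of the 𝐑
operation*, Commun. Math. Phys. **122**, 175–202 (1989), doi:10.1007/BF01257412, bib `Balaban1989LargeFieldI` (cell
paper B15; PDF held `paper:balaban1989-cmp122-large-field-i`; pp. 185–186 = PDF 11–12, OCR `p0011.txt`/`p0012.txt` and the
x2 renders); "[III]" = [Balaban1988Convergent] (2.4)/(2.5) (`Setup.epsK`, `B14.IsRj`, `B15.Ineq194Flow.deltaPrimeK`, `logPow`).
WHAT IS REPRODUCED: SKELETON rows `B15.Eq1.46`/`B15.Eq1.48` (the sentences *"can be made arbitrarily small by choosing γ, or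
A₁/A₀ sufficiently small … Let us choose a bound for these two factors in the form αβ"*) and the scale-independence remark
p. 186, unit `lit-balaban-r12` gen 8, HOME `run/shared/lean/pub/lit-balaban/` (`lit-balaban-r12/ROWS-B15.md`; cell GAPS.md
G-B15-05 "located constants").  Used BY NAME, nothing restated: `B15GammaSmallness.logPow_ratio_le`,
`B15GammaSmallness.deltaPrimeK_le_sqrt`, Mathlib's `Real.tendsto_log_nhdsGT_zero`.

THE PRINTED TEXT (p. 186, verbatim): *"The remaining numerical factors in front of the exponential can be estimated by
9B₃(A₁/A₀)(p₁(γ)/p₀(γ))(1 + β₀), and can be made arbitrarily small by choosing γ, or A₁/A₀ sufficiently small. Notice, that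
the conditions on M, γ, A₀, and A₁ introduced above do not depend on any scale, i.e., on i, j, k, and so on. This applies
also to other conditions introduced before. The numerical factor 8B₃L^{−i}δ′_j < 8B₃γA₁p₁(γ) can be also chosen arbitrarily
small for γ sufficiently small. Let us choose a bound for these two factors in the form αβ, where an absolute constant α will
be chosen later."*  (p. 185: *"We assume that it [γ] is so small that the expression on the left-hand side of (1.37) can be
bounded by ½δ_j"*.)

THE CLAUSES.  The files of this block derive the printed smallness statements from EXPLICIT inequalities in γ with all other
symbols fixed (`d, B₃, β, β₀, α, A₀, A₁, p₀, p₁` and located `O(1)`'s `C`): `γ < 1`; `1 ≤ log γ⁻²`, `4/3 < log γ⁻²`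
(`B15Ineq142Proof` §2), `2p ≤ log γ⁻²` (`B15GammaSmallness.mul_logPow_mono`); `128B₃A₁(4p₁)^{p₁}√γ ≤ 1`
(`smallness146_of_gamma`); `B₃22d²γ² < β/10` ((1.31), `ineq131_input_of_gamma`); `C·B₃22d²(1+β₀)(A₀/A₁)γ² ≤ ½` ((1.42),
`ineq142_second_of_gamma`); `11d²B₃γ² < α` ((1.90), `alpha_clause190_of_gamma`); `c·B₃(4(log γ⁻²)⁻¹ + 44d²(1+β₀)(A₀/A₁)γ²) ≤ ½`
((1.37)/(1.39), `ineq137_half_of_gamma`); `C·A₁ < A₀log γ⁻²` (Note@184, `smallness184_of_gamma`); `C·A₀(2q)^q·γ < A₁`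
((1.54)/(1.58), `B15Ineq158Bound.smallness158_of_gamma`); and the two (1.48) majorisations in γ-form
`9B₃(A₁/A₀)(log γ⁻²)⁻¹(1+β₀) ≤ αβ`, `8B₃A₁(4p₁)^{p₁}√γ ≤ αβ` (this file, §2).  Here `log γ⁻²` is `Real.log (γ ^ 2)⁻¹`.

WHAT THIS FILE PROVES (kernel-checked, zero `sorry`; no `def`, no new `Prop`, no new named fact; axioms standard).
* §1 `tendsto_log_inv_sq_atTop` — `log γ⁻² → +∞` as `γ → 0⁺`; private tools (`K·γⁿ`, `K·√γ`, `K·(log γ⁻²)⁻¹` eventually `< ε`).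
* §2 `alpha1_clause148_of_gamma`, `alpha2_clause148_of_gamma` — the hypotheses `hα₁ : 9B₃·ratio·(1+β₀) ≤ αβ` (with the p. 183
  ratio `(A₁/A₀)(log g_j⁻²)^{p₁−p₀}`, `p₁ < p₀`) and `hα₂ : 8B₃L^{−i}δ′_j ≤ αβ` of p29/b01's `B15Ineq148Proof.ineq148_of_146_147`
  from `0 < g_j ≤ γ`, `log γ⁻² ≥ 1`, signs, and the two γ-clauses above (along the flow for `hα₂`).
* §3 **`gamma_clauses_eventually`** — for fixed constants with `β, α, A₀, A₁, αβ > 0`, ALL the clauses listed hold for every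
  `γ` in a right neighbourhood of `0` (`∀ᶠ γ in 𝓝[>] 0, …`, a 14-fold conjunction) — no scale index occurs in the statement;
  `exists_gamma0_of_eventually` — extraction of a threshold `γ₀ > 0` with the property on `(0, γ₀]`; **`exists_gamma0_clauses`**
  — the printed form: *there is γ₀ > 0 such that for all 0 < γ ≤ γ₀ every clause holds*.
* §4 (v1.1) `M_clauses_eventually`, `M2_clauses_eventually`, `exists_M0_clauses` — the `M`/`M₂`-conditions (`δ(M/M₁) ≥ 2`,
  `δM ≥ L+1`, `τM ≥ 1`; `δ2M₂ ≥ 1`, `δLM₂ ≥ 1`, `δ2LM₂ > 1`) hold for all large `M`, `M₂` (*"We choose M large enough"*, p. 186).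
HONEST SCOPE.  Existence of a threshold only (no explicit γ₀ is computed; each clause separately is explicit in the files
cited); the alternative *"or A₁/A₀ sufficiently small"* is not used; `M`-conditions are γ-free and are treated separately in §4 (v1.1).  NOT summit progress.
-/

open Filter Topology

namespace Literature.MathematicalPhysics.QuantumFieldTheory.Balaban1983to89.B15GammaClauses

open Literature.MathematicalPhysics.QuantumFieldTheory.Balaban1983to89
open B15.Ineq194Flow B15GammaSmallness B14FlowStep

/-! ## §1. Limits as `γ → 0⁺` -/

/-- `log γ⁻² = log (γ²)⁻¹ → +∞` as `γ → 0⁺` (the mechanism behind *"for γ sufficiently small"*, pp. 185–186).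
[cite: Balaban1989LargeFieldI, p.186] -/
theorem tendsto_log_inv_sq_atTop : Tendsto (fun γ : ℝ => Real.log (γ ^ 2)⁻¹) (𝓝[>] 0) atTop := by
  have h := (Real.tendsto_log_nhdsGT_zero).const_mul_atBot_of_neg (by norm_num : (-2 : ℝ) < 0)
  refine h.congr fun γ => ?_
  rw [Real.log_inv, Real.log_pow]
  push_cast
  ring

/-- `K·γⁿ < ε` for all small `γ > 0` (`n ≠ 0`, `ε > 0`). [folklore] -/
private theorem eventually_const_mul_pow_lt (K : ℝ) {n : ℕ} (hn : n ≠ 0) {ε : ℝ} (hε : 0 < ε) :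
    ∀ᶠ γ in 𝓝[>] (0 : ℝ), K * γ ^ n < ε := by
  have h : Tendsto (fun γ : ℝ => K * γ ^ n) (𝓝 0) (𝓝 (K * 0 ^ n)) :=
    (continuous_const.mul (continuous_pow n)).tendsto 0
  rw [zero_pow hn, mul_zero] at h
  exact (h.eventually (Iio_mem_nhds hε)).filter_mono nhdsWithin_le_nhds

/-- `K·√γ < ε` for all small `γ > 0` (`ε > 0`). [folklore] -/
private theorem eventually_const_mul_sqrt_lt (K : ℝ) {ε : ℝ} (hε : 0 < ε) :
    ∀ᶠ γ in 𝓝[>] (0 : ℝ), K * Real.sqrt γ < ε := by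
  have h : Tendsto (fun γ : ℝ => K * Real.sqrt γ) (𝓝 0) (𝓝 (K * Real.sqrt 0)) :=
    (continuous_const.mul Real.continuous_sqrt).tendsto 0
  rw [Real.sqrt_zero, mul_zero] at h
  exact (h.eventually (Iio_mem_nhds hε)).filter_mono nhdsWithin_le_nhds

/-- `K·(log γ⁻²)⁻¹ < ε` for all small `γ > 0` (`ε > 0`). [folklore] -/
private theorem eventually_const_mul_inv_log_lt (K : ℝ) {ε : ℝ} (hε : 0 < ε) :
    ∀ᶠ γ in 𝓝[>] (0 : ℝ), K * (Real.log (γ ^ 2)⁻¹)⁻¹ < ε := by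
  have h : Tendsto (fun γ : ℝ => K * (Real.log (γ ^ 2)⁻¹)⁻¹) (𝓝[>] 0) (𝓝 (K * 0)) :=
    tendsto_log_inv_sq_atTop.inv_tendsto_atTop.const_mul K
  rw [mul_zero] at h
  exact h.eventually (Iio_mem_nhds hε)

/-- `M ≤ log γ⁻²` for all small `γ > 0`. [folklore] -/
private theorem eventually_le_log (M : ℝ) : ∀ᶠ γ in 𝓝[>] (0 : ℝ), M ≤ Real.log (γ ^ 2)⁻¹ :=
  tendsto_log_inv_sq_atTop.eventually_ge_atTop M

/-- `M < log γ⁻²` for all small `γ > 0`. [folklore] -/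
private theorem eventually_lt_log (M : ℝ) : ∀ᶠ γ in 𝓝[>] (0 : ℝ), M < Real.log (γ ^ 2)⁻¹ :=
  tendsto_log_inv_sq_atTop.eventually_gt_atTop M

/-- The (1.37)/(1.39) clause `c·B₃(4(log γ⁻²)⁻¹ + 44d²(1+β₀)(A₀/A₁)γ²) ≤ ½` for all small `γ > 0`. [folklore] -/
private theorem eventually_clause137 (c B₃ d β₀ A₀ A₁ : ℝ) : ∀ᶠ γ in 𝓝[>] (0 : ℝ),
    c * B₃ * (4 * (Real.log (γ ^ 2)⁻¹)⁻¹ + 44 * d ^ 2 * (1 + β₀) * (A₀ / A₁) * γ ^ 2) ≤ 1 / 2 := by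
  have h1 : Tendsto (fun γ : ℝ => (Real.log (γ ^ 2)⁻¹)⁻¹) (𝓝[>] 0) (𝓝 0) :=
    tendsto_log_inv_sq_atTop.inv_tendsto_atTop
  have h2 : Tendsto (fun γ : ℝ => γ ^ 2) (𝓝[>] 0) (𝓝 0) := by
    have h := (continuous_pow 2).tendsto (0 : ℝ)
    rw [zero_pow two_ne_zero] at h
    exact tendsto_nhdsWithin_of_tendsto_nhds h
  have h : Tendsto (fun γ : ℝ => c * B₃ * (4 * (Real.log (γ ^ 2)⁻¹)⁻¹ + 44 * d ^ 2 * (1 + β₀) * (A₀ / A₁) * γ ^ 2))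
      (𝓝[>] 0) (𝓝 (c * B₃ * (4 * 0 + 44 * d ^ 2 * (1 + β₀) * (A₀ / A₁) * 0))) :=
    ((h1.const_mul 4).add (h2.const_mul (44 * d ^ 2 * (1 + β₀) * (A₀ / A₁)))).const_mul (c * B₃)
  rw [mul_zero, mul_zero, add_zero, mul_zero] at h
  exact (h.eventually (Iio_mem_nhds (by norm_num : (0 : ℝ) < 1 / 2))).mono fun _ hx => le_of_lt hx

/-! ## §2. The two αβ-majorisations of (1.48) from γ -/

/-- **p. 186**, first factor: *"9B₃(A₁/A₀)(p₁(γ)/p₀(γ))(1 + β₀) … can be made arbitrarily small by choosing γ … Let us choose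
a bound … in the form αβ"* — the hypothesis `hα₁` of `B15Ineq148Proof.ineq148_of_146_147` with the p. 183 ratio
`(A₁/A₀)·(log g_j⁻²)^{p₁}/(log g_j⁻²)^{p₀}` (`δ′_j/ε_j`), `p₁ < p₀`: from `0 < g_j ≤ γ`, `log γ⁻² ≥ 1`, the sign
`9B₃(A₁/A₀)(1+β₀) ≥ 0` and the γ-clause `9B₃(A₁/A₀)(log γ⁻²)⁻¹(1+β₀) ≤ αβ`. [cite: Balaban1989LargeFieldI, (1.48) p.186] -/
theorem alpha1_clause148_of_gamma {γ : ℝ} {p₀ p₁ : ℕ} (hp : p₁ < p₀) {g B₃ β₀ A₀ A₁ αβ : ℝ} (hg : 0 < g) (hgγ : g ≤ γ)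
    (hγe : 1 ≤ Real.log (γ ^ 2)⁻¹) (hK : 0 ≤ 9 * B₃ * (A₁ / A₀) * (1 + β₀))
    (hγ : 9 * B₃ * (A₁ / A₀) * (Real.log (γ ^ 2)⁻¹)⁻¹ * (1 + β₀) ≤ αβ) :
    9 * B₃ * (A₁ / A₀ * (logPow p₁ g / logPow p₀ g)) * (1 + β₀) ≤ αβ := by
  have h1 := logPow_ratio_le (γ := γ) hp hg hgγ hγe
  have h2 := mul_le_mul_of_nonneg_left h1 hK
  calc 9 * B₃ * (A₁ / A₀ * (logPow p₁ g / logPow p₀ g)) * (1 + β₀)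
      = 9 * B₃ * (A₁ / A₀) * (1 + β₀) * (logPow p₁ g / logPow p₀ g) := by ring
    _ ≤ 9 * B₃ * (A₁ / A₀) * (1 + β₀) * (Real.log (γ ^ 2)⁻¹)⁻¹ := h2
    _ = 9 * B₃ * (A₁ / A₀) * (Real.log (γ ^ 2)⁻¹)⁻¹ * (1 + β₀) := by ring
    _ ≤ αβ := hγ

section Flow

variable {F : Flow} {γ : ℝ} {K : ℕ}

/-- **p. 186**, second factor: *"The numerical factor 8B₃L^{−i}δ′_j < 8B₃γA₁p₁(γ) can be also chosen arbitrarily small for γ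
sufficiently small"* — the hypothesis `hα₂` of `B15Ineq148Proof.ineq148_of_146_147` along a flow of the [III] setting: for
`j ≤ K` (`0 < g_j ≤ γ ≤ 1`), `0 ≤ L^{−i} ≤ 1`, `B₃, A₁ ≥ 0`, `p₁ ≥ 1`, and the γ-clause `8B₃A₁(4p₁)^{p₁}√γ ≤ αβ`
(`δ′_j ≤ A₁(4p₁)^{p₁}√γ`, `B15GammaSmallness.deltaPrimeK_le_sqrt`). [cite: Balaban1989LargeFieldI, (1.48) p.186] -/
theorem alpha2_clause148_of_gamma {A₁ B₃ Linv αβ : ℝ} (hB₃ : 0 ≤ B₃) (hA₁ : 0 ≤ A₁) {p₁ : ℕ} (hp₁ : 1 ≤ p₁)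
    (hI : F.InInterval γ K) (hγ1 : γ ≤ 1) (hL0 : 0 ≤ Linv) (hL1 : Linv ≤ 1)
    (hγ : 8 * B₃ * (A₁ * (4 * (p₁ : ℝ)) ^ p₁ * Real.sqrt γ) ≤ αβ) {j : ℕ} (hj : j ≤ K) :
    8 * B₃ * Linv * deltaPrimeK A₁ p₁ F j ≤ αβ := by
  have h1 := deltaPrimeK_le_sqrt (F := F) hA₁ hp₁ hI hγ1 hj
  have hδ0 : 0 ≤ A₁ * (4 * (p₁ : ℝ)) ^ p₁ * Real.sqrt γ := by positivity
  calc 8 * B₃ * Linv * deltaPrimeK A₁ p₁ F j ≤ 8 * B₃ * Linv * (A₁ * (4 * (p₁ : ℝ)) ^ p₁ * Real.sqrt γ) :=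
        mul_le_mul_of_nonneg_left h1 (by positivity)
    _ ≤ 8 * B₃ * 1 * (A₁ * (4 * (p₁ : ℝ)) ^ p₁ * Real.sqrt γ) := by
        apply mul_le_mul_of_nonneg_right _ hδ0
        exact mul_le_mul_of_nonneg_left hL1 (by positivity)
    _ = 8 * B₃ * (A₁ * (4 * (p₁ : ℝ)) ^ p₁ * Real.sqrt γ) := by ring
    _ ≤ αβ := hγ

end Flow

/-! ## §3. All clauses at once for small γ -/

/-- **p. 186** *"Notice, that the conditions on M, γ, A₀, and A₁ introduced above do not depend on any scale, i.e., on i, j,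
k, and so on. This applies also to other conditions introduced before"*, with *"can be made arbitrarily small by choosing γ …
sufficiently small"* (p. 186) and *"We assume that it is so small that …"* (p. 185): for FIXED `d, B₃, β, β₀, α, A₀, A₁, p₀,
p₁, q` and located constants `C₁, C₂, C₃, c`, with `β, α, A₀, A₁, αβ > 0`, EVERY explicit γ-clause under which this block's
files derive the printed smallness statements (list in the module docstring) holds for all `γ` in a right neighbourhood of
`0` — simultaneously, and with no scale index in the statement. [cite: Balaban1989LargeFieldI, p.186] -/
theorem gamma_clauses_eventually {β α A₀ A₁ αβ : ℝ} (hβ : 0 < β) (hα : 0 < α) (hA₀ : 0 < A₀) (hA₁ : 0 < A₁)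
    (hαβ : 0 < αβ) (B₃ d β₀ C₁ C₂ C₃ c : ℝ) (p₀ p₁ q : ℕ) :
    ∀ᶠ γ in 𝓝[>] (0 : ℝ),
      γ < 1 ∧ 1 ≤ Real.log (γ ^ 2)⁻¹ ∧ 4 / 3 < Real.log (γ ^ 2)⁻¹ ∧ 2 * (p₀ : ℝ) ≤ Real.log (γ ^ 2)⁻¹ ∧
      128 * B₃ * (A₁ * (4 * (p₁ : ℝ)) ^ p₁ * Real.sqrt γ) ≤ 1 ∧
      B₃ * (22 * d ^ 2) * γ ^ 2 < β / 10 ∧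
      C₁ * B₃ * (22 * d ^ 2) * (1 + β₀) * (A₀ / A₁) * γ ^ 2 ≤ 1 / 2 ∧
      11 * d ^ 2 * B₃ * γ ^ 2 < α ∧
      c * B₃ * (4 * (Real.log (γ ^ 2)⁻¹)⁻¹ + 44 * d ^ 2 * (1 + β₀) * (A₀ / A₁) * γ ^ 2) ≤ 1 / 2 ∧
      C₂ * A₁ < A₀ * Real.log (γ ^ 2)⁻¹ ∧
      C₃ * A₀ * (2 * (q : ℝ)) ^ q * γ < A₁ ∧
      9 * B₃ * (A₁ / A₀) * (Real.log (γ ^ 2)⁻¹)⁻¹ * (1 + β₀) ≤ αβ ∧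
      8 * B₃ * (A₁ * (4 * (p₁ : ℝ)) ^ p₁ * Real.sqrt γ) ≤ αβ := by
  have h0' : ∀ᶠ γ in 𝓝 (0 : ℝ), γ < 1 := Iio_mem_nhds zero_lt_one
  have h0 : ∀ᶠ γ in 𝓝[>] (0 : ℝ), γ < 1 := h0'.filter_mono nhdsWithin_le_nhds
  have h1 := eventually_le_log (1 : ℝ)
  have h2 := eventually_lt_log (4 / 3 : ℝ)
  have h3 := eventually_le_log (2 * (p₀ : ℝ))
  have h4 : ∀ᶠ γ in 𝓝[>] (0 : ℝ), 128 * B₃ * (A₁ * (4 * (p₁ : ℝ)) ^ p₁ * Real.sqrt γ) ≤ 1 :=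
    (eventually_const_mul_sqrt_lt (128 * B₃ * (A₁ * (4 * (p₁ : ℝ)) ^ p₁)) zero_lt_one).mono fun γ h => by
      have : 128 * B₃ * (A₁ * (4 * (p₁ : ℝ)) ^ p₁ * Real.sqrt γ) = 128 * B₃ * (A₁ * (4 * (p₁ : ℝ)) ^ p₁) * Real.sqrt γ := by
        ring
      rw [this]; exact h.le
  have h5 : ∀ᶠ γ in 𝓝[>] (0 : ℝ), B₃ * (22 * d ^ 2) * γ ^ 2 < β / 10 :=
    eventually_const_mul_pow_lt _ two_ne_zero (by positivity)
  have h6 : ∀ᶠ γ in 𝓝[>] (0 : ℝ), C₁ * B₃ * (22 * d ^ 2) * (1 + β₀) * (A₀ / A₁) * γ ^ 2 ≤ 1 / 2 :=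
    (eventually_const_mul_pow_lt _ two_ne_zero (by norm_num : (0 : ℝ) < 1 / 2)).mono fun _ h => h.le
  have h7 : ∀ᶠ γ in 𝓝[>] (0 : ℝ), 11 * d ^ 2 * B₃ * γ ^ 2 < α := eventually_const_mul_pow_lt _ two_ne_zero hα
  have h8 := eventually_clause137 c B₃ d β₀ A₀ A₁
  have h9 : ∀ᶠ γ in 𝓝[>] (0 : ℝ), C₂ * A₁ < A₀ * Real.log (γ ^ 2)⁻¹ :=
    (tendsto_log_inv_sq_atTop.const_mul_atTop hA₀).eventually_gt_atTop (C₂ * A₁)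
  have h10 : ∀ᶠ γ in 𝓝[>] (0 : ℝ), C₃ * A₀ * (2 * (q : ℝ)) ^ q * γ < A₁ := by
    have h := eventually_const_mul_pow_lt (C₃ * A₀ * (2 * (q : ℝ)) ^ q) one_ne_zero hA₁
    exact h.mono fun γ hγ => by simpa [pow_one] using hγ
  have h11 : ∀ᶠ γ in 𝓝[>] (0 : ℝ), 9 * B₃ * (A₁ / A₀) * (Real.log (γ ^ 2)⁻¹)⁻¹ * (1 + β₀) ≤ αβ :=
    (eventually_const_mul_inv_log_lt (9 * B₃ * (A₁ / A₀) * (1 + β₀)) hαβ).mono fun γ h => by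
      have : 9 * B₃ * (A₁ / A₀) * (Real.log (γ ^ 2)⁻¹)⁻¹ * (1 + β₀)
          = 9 * B₃ * (A₁ / A₀) * (1 + β₀) * (Real.log (γ ^ 2)⁻¹)⁻¹ := by ring
      rw [this]; exact h.le
  have h12 : ∀ᶠ γ in 𝓝[>] (0 : ℝ), 8 * B₃ * (A₁ * (4 * (p₁ : ℝ)) ^ p₁ * Real.sqrt γ) ≤ αβ :=
    (eventually_const_mul_sqrt_lt (8 * B₃ * (A₁ * (4 * (p₁ : ℝ)) ^ p₁)) hαβ).mono fun γ h => by
      have : 8 * B₃ * (A₁ * (4 * (p₁ : ℝ)) ^ p₁ * Real.sqrt γ) = 8 * B₃ * (A₁ * (4 * (p₁ : ℝ)) ^ p₁) * Real.sqrt γ := by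
        ring
      rw [this]; exact h.le
  filter_upwards [h0, h1, h2, h3, h4, h5, h6, h7, h8, h9, h10, h11, h12] with γ a0 a1 a2 a3 a4 a5 a6 a7 a8 a9 a10 a11 a12
  exact ⟨a0, a1, a2, a3, a4, a5, a6, a7, a8, a9, a10, a11, a12⟩

/-- Extraction of a threshold: a property of all `γ` in a right neighbourhood of `0` holds on a whole interval `(0, γ₀]`,
`γ₀ > 0`. [folklore] -/
private theorem exists_gamma0_of_eventually {P : ℝ → Prop} (h : ∀ᶠ γ in 𝓝[>] (0 : ℝ), P γ) :
    ∃ γ₀ : ℝ, 0 < γ₀ ∧ ∀ γ, 0 < γ → γ ≤ γ₀ → P γ := by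
  obtain ⟨u, hu, hsub⟩ := mem_nhdsGT_iff_exists_Ioc_subset.1 h
  exact ⟨u, hu, fun γ h0 h1 => hsub ⟨h0, h1⟩⟩

/-- **p. 186, printed form** — *there is γ₀ > 0 (depending only on d, B₃, β, β₀, α, A₀, A₁, p₀, p₁, q and the located
constants, NOT on any scale i, j, k) such that for every 0 < γ ≤ γ₀ all the γ-clauses of this block hold*.
[cite: Balaban1989LargeFieldI, p.186] -/
theorem exists_gamma0_clauses {β α A₀ A₁ αβ : ℝ} (hβ : 0 < β) (hα : 0 < α) (hA₀ : 0 < A₀) (hA₁ : 0 < A₁)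
    (hαβ : 0 < αβ) (B₃ d β₀ C₁ C₂ C₃ c : ℝ) (p₀ p₁ q : ℕ) :
    ∃ γ₀ : ℝ, 0 < γ₀ ∧ ∀ γ, 0 < γ → γ ≤ γ₀ →
      γ < 1 ∧ 1 ≤ Real.log (γ ^ 2)⁻¹ ∧ 4 / 3 < Real.log (γ ^ 2)⁻¹ ∧ 2 * (p₀ : ℝ) ≤ Real.log (γ ^ 2)⁻¹ ∧
      128 * B₃ * (A₁ * (4 * (p₁ : ℝ)) ^ p₁ * Real.sqrt γ) ≤ 1 ∧
      B₃ * (22 * d ^ 2) * γ ^ 2 < β / 10 ∧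
      C₁ * B₃ * (22 * d ^ 2) * (1 + β₀) * (A₀ / A₁) * γ ^ 2 ≤ 1 / 2 ∧
      11 * d ^ 2 * B₃ * γ ^ 2 < α ∧
      c * B₃ * (4 * (Real.log (γ ^ 2)⁻¹)⁻¹ + 44 * d ^ 2 * (1 + β₀) * (A₀ / A₁) * γ ^ 2) ≤ 1 / 2 ∧
      C₂ * A₁ < A₀ * Real.log (γ ^ 2)⁻¹ ∧
      C₃ * A₀ * (2 * (q : ℝ)) ^ q * γ < A₁ ∧
      9 * B₃ * (A₁ / A₀) * (Real.log (γ ^ 2)⁻¹)⁻¹ * (1 + β₀) ≤ αβ ∧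
      8 * B₃ * (A₁ * (4 * (p₁ : ℝ)) ^ p₁ * Real.sqrt γ) ≤ αβ :=
  exists_gamma0_of_eventually (gamma_clauses_eventually hβ hα hA₀ hA₁ hαβ B₃ d β₀ C₁ C₂ C₃ c p₀ p₁ q)

/-! ## §4 (v1.1). The conditions on `M` (and `M₂`) — likewise scale-free, met for all large `M` -/

/-- **p. 186** *"Notice, that the conditions on M, γ, A₀, and A₁ introduced above do not depend on any scale"*, the `M`-part:
for fixed `δ, τ > 0`, `M₁ > 0`, `L`, the located `M`-clauses of this block — `δ(M/M₁) ≥ 2` ((1.47), here with the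
(190)/(2.61) rate `τ` as in `B15Ineq148From190`), `δM ≥ L + 1` ((1.57), `B15Ineq157Flow.ineq157_second`), `τM ≥ 1`
(`B15Ineq139From190`) — hold for every sufficiently large `M` (*"We choose M large enough, so that δ(M/M₁) ≧ 2"*, p. 186).
[cite: Balaban1989LargeFieldI, p.186] -/
theorem M_clauses_eventually {δ τ M₁ : ℝ} (hδ : 0 < δ) (hτ : 0 < τ) (hM₁ : 0 < M₁) (L : ℝ) :
    ∀ᶠ M in atTop, 2 ≤ τ * (M / M₁) ∧ L + 1 ≤ δ * M ∧ 1 ≤ τ * M := by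
  have h1 : Tendsto (fun M : ℝ => τ * (M / M₁)) atTop atTop :=
    (tendsto_id.atTop_div_const hM₁).const_mul_atTop hτ
  have h2 : Tendsto (fun M : ℝ => δ * M) atTop atTop := tendsto_id.const_mul_atTop hδ
  have h3 : Tendsto (fun M : ℝ => τ * M) atTop atTop := tendsto_id.const_mul_atTop hτ
  filter_upwards [h1.eventually_ge_atTop 2, h2.eventually_ge_atTop (L + 1), h3.eventually_ge_atTop 1] with M a b c
  exact ⟨a, b, c⟩

/-- The `M₂`-part (the cube-size constant of (1.30)–(1.31), (1.42), (1.90)): for `δ, L > 0` the located clauses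
`δ2M₂ ≥ 1` (`B15Ineq131Input`), `δLM₂ ≥ 1` (`B15Ineq142Proof`/`B15Ineq142From190`), `δ2LM₂ > 1` (`B15Ineq157Flow.boundH190_lt`)
hold for every sufficiently large `M₂`. [cite: Balaban1989LargeFieldI, p.186] -/
theorem M2_clauses_eventually {δ L : ℝ} (hδ : 0 < δ) (hL : 0 < L) :
    ∀ᶠ M₂ in atTop, 1 ≤ δ * 2 * M₂ ∧ 1 ≤ δ * L * M₂ ∧ 1 < δ * 2 * L * M₂ := by
  have h1 : Tendsto (fun M₂ : ℝ => δ * 2 * M₂) atTop atTop := tendsto_id.const_mul_atTop (by positivity)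
  have h2 : Tendsto (fun M₂ : ℝ => δ * L * M₂) atTop atTop := tendsto_id.const_mul_atTop (by positivity)
  have h3 : Tendsto (fun M₂ : ℝ => δ * 2 * L * M₂) atTop atTop := tendsto_id.const_mul_atTop (by positivity)
  filter_upwards [h1.eventually_ge_atTop 1, h2.eventually_ge_atTop 1, h3.eventually_gt_atTop 1] with M₂ a b c
  exact ⟨a, b, c⟩

/-- Extraction for `atTop`: a property of all large `M` holds from some threshold `M₀` on. [folklore] -/
private theorem exists_threshold_of_eventually {P : ℝ → Prop} (h : ∀ᶠ M in atTop, P M) :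
    ∃ M₀ : ℝ, ∀ M, M₀ ≤ M → P M := by
  obtain ⟨M₀, hM₀⟩ := h.exists_forall_of_atTop
  exact ⟨M₀, hM₀⟩

/-- **p. 186, printed form for `M`**: there is `M₀` (depending only on `δ, τ, M₁, L`) such that every `M ≥ M₀` satisfies the
three `M`-clauses. [cite: Balaban1989LargeFieldI, p.186] -/
theorem exists_M0_clauses {δ τ M₁ : ℝ} (hδ : 0 < δ) (hτ : 0 < τ) (hM₁ : 0 < M₁) (L : ℝ) :
    ∃ M₀ : ℝ, ∀ M, M₀ ≤ M → 2 ≤ τ * (M / M₁) ∧ L + 1 ≤ δ * M ∧ 1 ≤ τ * M :=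
  exists_threshold_of_eventually (M_clauses_eventually hδ hτ hM₁ L)

end Literature.MathematicalPhysics.QuantumFieldTheory.Balaban1983to89.B15GammaClauses
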